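import Summits.ValiantsHypothesis.ValiantsHypothesis.Theorems.LacunarySymmetroidMatrixDescartesOverlapWindow

/-!
# `MatrixDescartes` — the canonical cut budget of a live set: `#E_L − 1 ≤ (m + w)^w` for `#L ≤ w + 1`

HONEST FRAMING.  Object-search cell `pub-symmetroid`, crux `Theses.LacunarySymmetroid.MatrixDescartes` (ledger item
`stmt-ValiantsHypothesis-18050`, route `LacunarySymmetroid`; seat `val-sym-mdr-p2`, gen 13).  Nothing here bears on the crux,
`DoorA26` / `DoorA34`, the registers, or `VP ≠ VNP`.  Bookkeeping for the sector corollaries `Overlap.overlapSector_mdr`,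
`overlapSector_mdr_log`, `mixedCover_mdr`, which take per-window cut budgets `≤ (m + w)^w`: with the CANONICAL cuts (all live
exponents but the survivor) a live set of at most `w + 1` letters costs `#E_L − 1 ≤ C(w + m, m) − 1 ≤ (m + w)^w`
(`card_liveExps_le`, `Nat.choose_le_pow`).  [folklore]
-/

-- `Summit.ValiantsHypothesis.ValiantsHypothesis.…` repeats a component by the D-0017 layout (single-conjunct summit).
set_option linter.dupNamespace false

namespace Summit.ValiantsHypothesis.ValiantsHypothesis.Theorems.LacunarySymmetroidMatrixDescartes.Overlap

open Finset
open scoped BigOperators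

variable {K m : ℕ}

/-! ## §23 The canonical budget -/

/-- `C(w + m, m) ≤ (m + w)^w`. [folklore] -/
theorem choose_add_le_pow (m w : ℕ) : Nat.choose (w + m) m ≤ (m + w) ^ w := by
  rw [show w + m = m + w by omega, Nat.choose_symm_add]
  exact Nat.choose_le_pow (m + w) w

/-- **Canonical cut budget.**  If the live set has at most `w + 1` letters, its live exponent set has at most `(m + w)^w + 1`
elements, so the canonical cuts (all live exponents but one survivor) number at most `(m + w)^w`. [folklore] -/
theorem card_liveExps_sub_one_le_pow (d : Fin K → ℕ) (L : Finset (Fin K)) (w : ℕ) (hL : L.card ≤ w + 1) :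
    ((Fintype.piFinset fun _ : Fin m => L).image (fun f : Fin m → Fin K => ∑ i, d (f i))).card - 1 ≤ (m + w) ^ w := by
  have h1 := card_liveExps_le (m := m) d L
  have h2 : Nat.choose (L.card + m - 1) m ≤ Nat.choose (w + m) m := Nat.choose_le_choose m (by omega)
  have h3 := choose_add_le_pow m w
  omega

/-- The same for any cut set contained in the live exponent set minus one designated element. [folklore] -/
theorem card_cuts_le_pow (d : Fin K → ℕ) (L : Finset (Fin K)) (w : ℕ) (hL : L.card ≤ w + 1) (A : Finset ℕ) (a : ℕ)
    (ha : a ∈ (Fintype.piFinset fun _ : Fin m => L).image (fun f : Fin m → Fin K => ∑ i, d (f i)))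
    (hA : A ⊆ ((Fintype.piFinset fun _ : Fin m => L).image (fun f : Fin m → Fin K => ∑ i, d (f i))).erase a) :
    A.card ≤ (m + w) ^ w := by
  have h1 := Finset.card_le_card hA
  rw [Finset.card_erase_of_mem ha] at h1
  exact h1.trans (card_liveExps_sub_one_le_pow d L w hL)

end Summit.ValiantsHypothesis.ValiantsHypothesis.Theorems.LacunarySymmetroidMatrixDescartes.Overlap
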